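import Literature.MathematicalPhysics.StatisticalMechanics.TorusFRDFourier
import HarnessLib

/-!
# Fourier-multiplier kernels on the discrete torus: positivity, the decomposition identity, finite range

Topic `Literature/MathematicalPhysics/StatisticalMechanics`.  Continuation of `TorusFRDFourier.lean`
towards the discharge of `GradientFRD.TorusFRD` (Buchholz, J. Funct. Anal. 275 (2018), Thm 2.4): the
translation-invariant kernel with a real, even Fourier multiplier `m`,

  `mulKernel m x = Re ( M^{-d} Σ_κ m(κ) χ_κ(x) )`   (Buchholz's `M_k(x)`, p. 9 and App. A),

and the facts about it that the decomposition uses: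

* `fourierCoeff_mulKernel` (`𝓕(mulKernel m) = m`), `sum_mulKernel` (zero average iff `m(0) = 0`),
  `mulKernel_neg` (evenness), `sum_sum_mulKernel` / `mulKernel_posSemidef` (the quadratic form is
  `M^{-d} Σ_κ m(κ) |φ̂(κ)|² ≥ 0` for `m ≥ 0`);
* `ellOp_conv_mulKernel` — the DECOMPOSITION IDENTITY: if `m(κ) â(κ) = 1` for `κ ≠ 0` then
  `∇*A∇ (mulKernel m ⋆ φ) = φ` for every `φ` with `Σ φ = 0` (Buchholz (1.4)/(2.11));
* `mulKernel_poly_eq_const` — FINITE RANGE of polynomial multipliers: if `m(κ) = P(â(κ))` for `κ ≠ 0`,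
  `m(0) = 0`, then `mulKernel m (x) = −P(0)/M^d` whenever `|x|_∞ > deg P` (Buchholz p. 9: "polynomials
  `P_t` such that `[P_t(𝒜)](x,y) = 0` for `ρ(x,y) > t`", with the constant `M_k` of Thm 2.4 (iii));
* `iterDiff_mulKernel_eq_sum`, `abs_sum_mul_re_le` — the real-space representation
  `∇^α mulKernel m (x) = Σ_κ m(κ) Re(M^{-d} q(κ)^α χ_κ(x))` and its bound by `M^{-d} Σ_κ |m(κ)| |p(κ)|^{|α|}`
  (Buchholz (A.12)).

Everything is proved; no named facts.

## References
* S. Buchholz, *Finite range decomposition for Gaussian measures with improved regularity*,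
  J. Funct. Anal. 275 (2018), §2–§3 and App. A [Buchholz2016].
-/

noncomputable section

namespace Literature.MathematicalPhysics.StatisticalMechanics.GradientFRD

open Finset Complex Polynomial Literature.Probability.LatticeModels
open scoped Real ComplexConjugate BigOperators

variable {d M : ℕ} [NeZero M]

/-! ## Multiplier kernels -/

/-- The complex multiplier sum `M^{-d} Σ_κ m(κ) χ_κ(x)`. [cite: Buchholz2016, §3 (M_k, p. 9)] -/
def mulSum (m : (Fin d → ZMod M) → ℝ) (x : Fin d → ZMod M) : ℂ :=
  (((M : ℂ) ^ d))⁻¹ * ∑ κ, (m κ : ℂ) * torusChar κ x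

/-- The multiplier kernel `mulKernel m (x) = Re(M^{-d} Σ_κ m(κ) χ_κ(x))`. [cite: Buchholz2016, §3 (M_k, p. 9)] -/
def mulKernel (m : (Fin d → ZMod M) → ℝ) (x : Fin d → ZMod M) : ℝ := (mulSum m x).re

/-- `mulSum m = 𝓕⁻¹ m`. [cite: Buchholz2016, §2 (2.15)] -/
theorem mulSum_eq_torusFourierInv (m : (Fin d → ZMod M) → ℝ) (x : Fin d → ZMod M) :
    mulSum m x = torusFourierInv (fun κ => (m κ : ℂ)) x := by
  rw [torusFourierInv_eq_sum_torusChar, mulSum]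

/-- `mulSum m (−x) = conj (mulSum m x)` for real `m`. [cite: Buchholz2016, §2 (2.15)] -/
theorem mulSum_neg (m : (Fin d → ZMod M) → ℝ) (x : Fin d → ZMod M) : mulSum m (-x) = conj (mulSum m x) := by
  unfold mulSum
  rw [map_mul, map_inv₀, map_pow, Complex.conj_natCast, map_sum]
  congr 1
  exact sum_congr rfl fun κ _ => by rw [map_mul, Complex.conj_ofReal, torusChar_neg_right]

/-- **Evenness** `mulKernel m (−x) = mulKernel m (x)`. [cite: Buchholz2016, Thm 2.4 (M_k(x) = M_k(−x))] -/
theorem mulKernel_neg (m : (Fin d → ZMod M) → ℝ) (x : Fin d → ZMod M) : mulKernel m (-x) = mulKernel m x := by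
  rw [mulKernel, mulKernel, mulSum_neg, Complex.conj_re]

/-- For an even multiplier the complex sum is real. [cite: Buchholz2016, §3 (p. 9)] -/
theorem conj_mulSum {m : (Fin d → ZMod M) → ℝ} (hm : ∀ κ, m (-κ) = m κ) (x : Fin d → ZMod M) :
    conj (mulSum m x) = mulSum m x := by
  rw [← mulSum_neg]
  unfold mulSum
  congr 1
  rw [← Equiv.sum_comp (Equiv.neg _) (fun κ => (m κ : ℂ) * torusChar κ x)]
  refine sum_congr rfl fun κ _ => ?_
  rw [Equiv.neg_apply, hm, torusChar_neg_right, torusChar_comm, ← torusChar_neg_right, torusChar_comm]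

/-- `(mulKernel m x : ℂ) = mulSum m x` for even `m`. [cite: Buchholz2016, §3 (p. 9)] -/
theorem mulKernel_coe {m : (Fin d → ZMod M) → ℝ} (hm : ∀ κ, m (-κ) = m κ) (x : Fin d → ZMod M) :
    (mulKernel m x : ℂ) = mulSum m x := by
  rw [mulKernel]; exact Complex.conj_eq_iff_re.1 (conj_mulSum hm x)

/-- **The Fourier transform of the multiplier kernel is the multiplier**: `𝓕(mulKernel m)(κ) = m(κ)`.
[cite: Buchholz2016, §2 (2.15)–(2.17)] -/
theorem fourierCoeff_mulKernel {m : (Fin d → ZMod M) → ℝ} (hm : ∀ κ, m (-κ) = m κ) (κ : Fin d → ZMod M) :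
    fourierCoeff (mulKernel m) κ = m κ := by
  rw [fourierCoeff_eq_sum]
  simp_rw [mulKernel_coe hm]
  unfold mulSum
  have h : ∑ x, (((M : ℂ) ^ d))⁻¹ * (∑ κ', (m κ' : ℂ) * torusChar κ' x) * conj (torusChar κ x) =
      (((M : ℂ) ^ d))⁻¹ * ∑ κ', (m κ' : ℂ) * ∑ x, torusChar (κ' - κ) x := by
    rw [Finset.mul_sum]
    simp_rw [Finset.mul_sum, Finset.sum_mul]
    rw [Finset.sum_comm]
    refine sum_congr rfl fun κ' _ => sum_congr rfl fun x _ => ?_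
    rw [torusChar_sub_left]; ring
  rw [h, sum_mul_sum_torusChar_sub_left, ← mul_assoc, inv_mul_cancel₀ natCast_pow_ne_zero, one_mul]

/-- `Σ_x mulKernel m (x) = m(0)`; in particular the kernel has ZERO AVERAGE iff `m(0) = 0`.
[cite: Buchholz2016, §1 (1.5)] -/
theorem sum_mulKernel {m : (Fin d → ZMod M) → ℝ} (hm : ∀ κ, m (-κ) = m κ) : ∑ x, mulKernel m x = m 0 := by
  have h := fourierCoeff_mulKernel hm 0
  rw [fourierCoeff_eq_sum] at h
  simp only [torusChar_zero_left, map_one, mul_one] at h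
  exact_mod_cast h

/-- `𝓕φ` in the statement's convention equals `torusFourier` of `φ`. [cite: Buchholz2016, §2 (2.14)] -/
theorem torusFourier_ofReal (φ : (Fin d → ZMod M) → ℝ) (κ : Fin d → ZMod M) :
    torusFourier (fun x => (φ x : ℂ)) κ = fourierCoeff φ κ := by
  rw [torusFourier_eq_sum_torusChar, fourierCoeff_eq_sum]

/-- **The quadratic form in Fourier variables**:
`Σ_{x,y} φ(x) mulKernel m (x−y) φ(y) = M^{-d} Σ_κ m(κ) |φ̂(κ)|²`. [cite: Buchholz2016, §1 (positivity via 𝓕)] -/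
theorem sum_sum_mulKernel (m φ : (Fin d → ZMod M) → ℝ) :
    ∑ x, ∑ y, φ x * mulKernel m (x - y) * φ y = (((M : ℝ) ^ d))⁻¹ * ∑ κ, m κ * ‖fourierCoeff φ κ‖ ^ 2 := by
  have h := sum_sum_mul_torusFourierInv_re (fun κ => (m κ : ℂ)) φ
  simp_rw [← mulSum_eq_torusFourierInv, Complex.ofReal_re, torusFourier_ofReal] at h
  rw [← h]
  exact sum_congr rfl fun x _ => sum_congr rfl fun y _ => by rw [mulKernel]; ring

/-- **Positivity**: a nonnegative multiplier gives a positive semi-definite kernel.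
[cite: Buchholz2016, Thm 2.4 ("positive, translation invariant maps")] -/
theorem mulKernel_posSemidef {m : (Fin d → ZMod M) → ℝ} (hm : ∀ κ, 0 ≤ m κ) (φ : (Fin d → ZMod M) → ℝ) :
    0 ≤ ∑ x, ∑ y, φ x * mulKernel m (x - y) * φ y := by
  rw [sum_sum_mulKernel]
  exact mul_nonneg (by positivity) (sum_nonneg fun κ _ => mul_nonneg (hm κ) (sq_nonneg _))

/-! ## The decomposition identity -/

/-- `φ̂(0) = Σ φ`. [cite: Buchholz2016, §1 (1.5)] -/
theorem fourierCoeff_zero (φ : (Fin d → ZMod M) → ℝ) : fourierCoeff φ 0 = ((∑ x, φ x : ℝ) : ℂ) := by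
  rw [fourierCoeff_eq_sum]; push_cast; simp

/-- **Decomposition identity**: if `m(κ) â(κ) = 1` for `κ ≠ 0` (symmetric `A`), then
`∇*A∇ (mulKernel m ⋆ φ) = φ` for all `φ` with `Σ φ = 0`. [cite: Buchholz2016, Thm 2.4 (𝒞_A = Σ 𝒞_{A,k})] -/
theorem ellOp_conv_mulKernel {A : Matrix (Fin d) (Fin d) ℝ} (hA : A.IsSymm) {m : (Fin d → ZMod M) → ℝ}
    (hm : ∀ κ, m (-κ) = m κ) (hinv : ∀ κ, κ ≠ 0 → m κ * symbR A κ = 1) (φ : (Fin d → ZMod M) → ℝ)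
    (hφ : ∑ x, φ x = 0) : ellOp A (conv (mulKernel m) φ) = φ := by
  refine eq_of_fourierCoeff_eq fun κ => ?_
  rw [fourierCoeff_ellOp, fourierCoeff_conv, fourierCoeff_mulKernel hm, symb_eq_symbR hA]
  rcases eq_or_ne κ 0 with hκ | hκ
  · rw [hκ, fourierCoeff_zero, hφ]; simp
  · have h := hinv κ hκ
    calc (symbR A κ : ℂ) * ((m κ : ℂ) * fourierCoeff φ κ) = ((m κ * symbR A κ : ℝ) : ℂ) * fourierCoeff φ κ := by
          push_cast; ring
      _ = fourierCoeff φ κ := by rw [h]; simp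

/-! ## The symbol is even; the complex operator and its action on characters -/

/-- `q_j(−κ) = conj q_j(κ)`. [cite: Buchholz2016, §2 (2.18)] -/
theorem qmode_neg (κ : Fin d → ZMod M) (j : Fin d) : qmode (-κ) j = conj (qmode κ j) := by
  rw [qmode, qmode, torusChar_comm, torusChar_neg_right, torusChar_comm, map_sub, map_one]

/-- The real symbol is even in `κ`. [cite: Buchholz2016, §2 (2.18)] -/
theorem symbR_neg (A : Matrix (Fin d) (Fin d) ℝ) (κ : Fin d → ZMod M) : symbR A (-κ) = symbR A κ := by
  unfold symbR
  simp only [qmode_neg, Complex.conj_re, Complex.conj_im]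
  exact sum_congr rfl fun i _ => sum_congr rfl fun j _ => by ring

/-- `∇*A∇` on complex functions, as a linear map. [cite: Buchholz2016, §2 (2.6)] -/
def ellOpC (A : Matrix (Fin d) (Fin d) ℝ) : ((Fin d → ZMod M) → ℂ) →ₗ[ℂ] ((Fin d → ZMod M) → ℂ) where
  toFun ψ x := ∑ i, ∑ j, (A i j : ℂ) *
    ((ψ (x - Pi.single i 1 + Pi.single j 1) - ψ (x - Pi.single i 1)) - (ψ (x + Pi.single j 1) - ψ x))
  map_add' ψ₁ ψ₂ := by
    funext x
    simp only [Pi.add_apply]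
    rw [← Finset.sum_add_distrib]
    refine sum_congr rfl fun i _ => ?_
    rw [← Finset.sum_add_distrib]
    refine sum_congr rfl fun j _ => ?_
    ring
  map_smul' c ψ := by
    funext x
    simp only [Pi.smul_apply, smul_eq_mul, RingHom.id_apply, Finset.mul_sum]
    refine sum_congr rfl fun i _ => sum_congr rfl fun j _ => ?_
    ring

omit [NeZero M] in
/-- `ellOpC` extends `ellOp`: on real functions they agree. [cite: Buchholz2016, §2 (2.6)] -/
theorem ellOpC_ofReal (A : Matrix (Fin d) (Fin d) ℝ) (φ : (Fin d → ZMod M) → ℝ) (x : Fin d → ZMod M) :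
    ellOpC A (fun y => (φ y : ℂ)) x = (ellOp A φ x : ℝ) := by
  simp only [ellOpC, LinearMap.coe_mk, AddHom.coe_mk, ellOp, bwdDiff, fwdDiff]
  push_cast
  rfl

/-- **Characters are eigenfunctions**: `∇*A∇ χ_κ = â(κ) χ_κ`. [cite: Buchholz2016, §2 (2.16)–(2.18)] -/
theorem ellOpC_torusChar (A : Matrix (Fin d) (Fin d) ℝ) (κ : Fin d → ZMod M) :
    ellOpC A (fun x => torusChar κ x) = symb A κ • fun x => torusChar κ x := by
  funext x
  simp only [ellOpC, LinearMap.coe_mk, AddHom.coe_mk, Pi.smul_apply, smul_eq_mul, symb, Finset.sum_mul]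
  refine sum_congr rfl fun i _ => sum_congr rfl fun j _ => ?_
  rw [torusChar_add_right, torusChar_sub_right, torusChar_add_right, qmode, qmode]
  simp only [map_one, map_sub]
  ring

/-- Iterates: `(∇*A∇)^r χ_κ = â(κ)^r χ_κ`. [cite: Buchholz2016, §2 (2.16)] -/
theorem ellOpC_pow_torusChar (A : Matrix (Fin d) (Fin d) ℝ) (κ : Fin d → ZMod M) (r : ℕ) :
    (ellOpC A ^ r) (fun x => torusChar κ x) = symb A κ ^ r • fun x => torusChar κ x := by
  induction r with
  | zero => simp
  | succ r ih => rw [pow_succ, Module.End.mul_apply, ellOpC_torusChar, map_smul, ih, smul_smul, pow_succ']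

/-- The delta function is the normalised character sum: `δ₀ = M^{-d} Σ_κ χ_κ`. [cite: Buchholz2016, §2 (2.15)] -/
theorem delta_eq_sum_torusChar :
    (fun x : Fin d → ZMod M => if x = 0 then (1 : ℂ) else 0) =
      (((M : ℂ) ^ d))⁻¹ • ∑ κ : Fin d → ZMod M, fun x => torusChar κ x := by
  funext x
  rw [Pi.smul_apply, Finset.sum_apply, sum_torusChar_left, smul_eq_mul]
  split_ifs
  · rw [inv_mul_cancel₀ natCast_pow_ne_zero]
  · rw [mul_zero]

/-- `(∇*A∇)^r δ₀ (x) = M^{-d} Σ_κ â(κ)^r χ_κ(x)`. [cite: Buchholz2016, §2 (2.15)–(2.16)] -/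
theorem ellOpC_pow_delta (A : Matrix (Fin d) (Fin d) ℝ) (r : ℕ) (x : Fin d → ZMod M) :
    (ellOpC A ^ r) (fun y : Fin d → ZMod M => if y = 0 then (1 : ℂ) else 0) x =
      (((M : ℂ) ^ d))⁻¹ * ∑ κ, symb A κ ^ r * torusChar κ x := by
  rw [delta_eq_sum_torusChar, map_smul, map_sum, Pi.smul_apply, Finset.sum_apply, smul_eq_mul]
  congr 1
  refine sum_congr rfl fun κ _ => ?_
  rw [ellOpC_pow_torusChar, Pi.smul_apply, smul_eq_mul]

/-! ## Finite range -/

/-- `|(z mod M)~| ≤ |z|`: the symmetric representative is the smallest. [cite: Buchholz2016, §2 (the metric d_∞ on T_N)] -/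
theorem natAbs_valMinAbs_intCast_le (z : ℤ) : ((z : ZMod M).valMinAbs).natAbs ≤ z.natAbs :=
  ZMod.natAbs_min_of_le_div_two M _ _ (ZMod.coe_valMinAbs _) (ZMod.natAbs_valMinAbs_le _)

omit [NeZero M] in
/-- Coordinates are bounded by the sup norm. [cite: Buchholz2016, §2 (the metric d_∞ on T_N)] -/
theorem natAbs_valMinAbs_le_supNorm (x : Fin d → ZMod M) (i : Fin d) : ((x i).valMinAbs).natAbs ≤ supNorm x :=
  Finset.le_sup (f := fun i => ((x i).valMinAbs).natAbs) (Finset.mem_univ i)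

omit [NeZero M] in
/-- **Triangle inequality** for the sup norm on the torus. [cite: Buchholz2016, §2 (the metric d_∞ on T_N)] -/
theorem supNorm_add_le (x y : Fin d → ZMod M) : supNorm (x + y) ≤ supNorm x + supNorm y := by
  unfold supNorm
  refine Finset.sup_le fun i _ => ?_
  rw [Pi.add_apply]
  refine (ZMod.natAbs_valMinAbs_add_le _ _).trans ((Int.natAbs_add_le _ _).trans ?_)
  exact add_le_add (natAbs_valMinAbs_le_supNorm x i) (natAbs_valMinAbs_le_supNorm y i)

omit [NeZero M] in
/-- `|−x|_∞ = |x|_∞`. [cite: Buchholz2016, §2 (the metric d_∞ on T_N)] -/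
theorem supNorm_neg (x : Fin d → ZMod M) : supNorm (-x) = supNorm x := by
  unfold supNorm
  exact congrArg _ (funext fun i => by rw [Pi.neg_apply, ZMod.natAbs_valMinAbs_neg])

omit [NeZero M] in
/-- `|x|_∞ ≤ |x + v|_∞ + |v|_∞`. [cite: Buchholz2016, §2 (the metric d_∞ on T_N)] -/
theorem supNorm_le_supNorm_add (x v : Fin d → ZMod M) : supNorm x ≤ supNorm (x + v) + supNorm v := by
  have h := supNorm_add_le (x + v) (-v)
  rwa [add_neg_cancel_right, supNorm_neg] at h

/-- `|e_j|_∞ ≤ 1`. [cite: Buchholz2016, §2 (the metric d_∞ on T_N)] -/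
theorem supNorm_single_le (j : Fin d) : supNorm (Pi.single j (1 : ZMod M) : Fin d → ZMod M) ≤ 1 := by
  unfold supNorm
  refine Finset.sup_le fun i _ => ?_
  rcases eq_or_ne i j with h | h
  · subst h
    rw [Pi.single_eq_same]
    have := natAbs_valMinAbs_intCast_le (M := M) 1
    simpa using this
  · rw [Pi.single_eq_of_ne h, ZMod.valMinAbs_zero]; simp

omit [NeZero M] in
/-- `|x|_∞ = 0 ↔ x = 0`. [cite: Buchholz2016, §2 (the metric d_∞ on T_N)] -/
theorem supNorm_eq_zero_iff (x : Fin d → ZMod M) : supNorm x = 0 ↔ x = 0 := by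
  constructor
  · intro h
    funext i
    have hi := natAbs_valMinAbs_le_supNorm x i
    rw [h, Nat.le_zero, Int.natAbs_eq_zero, ZMod.valMinAbs_eq_zero] at hi
    exact hi
  · rintro rfl
    unfold supNorm
    simp [ZMod.valMinAbs_zero]

/-- **Range growth**: `∇*A∇` enlarges the support by at most one in the sup norm.
[cite: Buchholz2016, §3 (p. 9, "P_t(𝒜)(x,y) = 0 for ρ(x,y) > t")] -/
theorem ellOpC_apply_eq_zero (A : Matrix (Fin d) (Fin d) ℝ) {ψ : (Fin d → ZMod M) → ℂ} {R : ℕ}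
    (hψ : ∀ y, R < supNorm y → ψ y = 0) (x : Fin d → ZMod M) (hx : R + 1 < supNorm x) : ellOpC A ψ x = 0 := by
  have hv : ∀ v : Fin d → ZMod M, supNorm v ≤ 1 → ψ (x + v) = 0 := fun v hv =>
    hψ _ (by have := supNorm_le_supNorm_add x v; omega)
  have h1 : ∀ i j : Fin d, ψ (x - Pi.single i 1 + Pi.single j 1) = 0 := by
    intro i j
    rw [show x - Pi.single i 1 + Pi.single j 1 = x + (Pi.single j 1 - Pi.single i 1) by abel]
    refine hv _ ?_
    -- `|e_j − e_i|_∞ ≤ 1`: coordinates are `0, ±1`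
    unfold supNorm
    refine Finset.sup_le fun l _ => ?_
    rw [Pi.sub_apply]
    rcases eq_or_ne l j with hj | hj <;> rcases eq_or_ne l i with hi | hi
    · subst hj; subst hi; simp [ZMod.valMinAbs_zero]
    · subst hj; rw [Pi.single_eq_same, Pi.single_eq_of_ne hi, sub_zero]
      simpa using natAbs_valMinAbs_intCast_le (M := M) 1
    · subst hi; rw [Pi.single_eq_same, Pi.single_eq_of_ne hj, zero_sub, ZMod.natAbs_valMinAbs_neg]
      simpa using natAbs_valMinAbs_intCast_le (M := M) 1
    · rw [Pi.single_eq_of_ne hj, Pi.single_eq_of_ne hi, sub_zero, ZMod.valMinAbs_zero]; simp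
  have h2 : ∀ i : Fin d, ψ (x - Pi.single i 1) = 0 := fun i => by
    rw [sub_eq_add_neg]; exact hv _ (by rw [supNorm_neg]; exact supNorm_single_le i)
  have h3 : ∀ j : Fin d, ψ (x + Pi.single j 1) = 0 := fun j => hv _ (supNorm_single_le j)
  have h4 : ψ x = 0 := hψ x (by omega)
  simp only [ellOpC, LinearMap.coe_mk, AddHom.coe_mk, h1, h2, h3, h4, sub_self, mul_zero, sum_const_zero]

/-- `(∇*A∇)^r δ₀` is supported in `{|x|_∞ ≤ r}`. [cite: Buchholz2016, §3 (p. 9)] -/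
theorem ellOpC_pow_delta_eq_zero (A : Matrix (Fin d) (Fin d) ℝ) (r : ℕ) (x : Fin d → ZMod M) (hx : r < supNorm x) :
    (ellOpC A ^ r) (fun y : Fin d → ZMod M => if y = 0 then (1 : ℂ) else 0) x = 0 := by
  induction r generalizing x with
  | zero =>
    simp only [pow_zero, Module.End.one_apply]
    rw [if_neg]
    intro h
    rw [h, (supNorm_eq_zero_iff (0 : Fin d → ZMod M)).2 rfl] at hx
    exact Nat.lt_irrefl 0 hx
  | succ r ih =>
    rw [pow_succ', Module.End.mul_apply]
    exact ellOpC_apply_eq_zero A (fun y hy => ih y hy) x (by omega)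

/-- The character sum of a polynomial in the symbol vanishes beyond the degree:
`Σ_κ P(â(κ)) χ_κ(x) = 0` for `|x|_∞ > deg P`. [cite: Buchholz2016, §3 (p. 9)] -/
theorem sum_poly_symbR_torusChar_eq_zero {A : Matrix (Fin d) (Fin d) ℝ} (hA : A.IsSymm) (P : ℝ[X])
    (x : Fin d → ZMod M) (hx : P.natDegree < supNorm x) :
    ∑ κ, ((P.eval (symbR A κ) : ℝ) : ℂ) * torusChar κ x = 0 := by
  have hexp : ∀ κ : Fin d → ZMod M, ((P.eval (symbR A κ) : ℝ) : ℂ) =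
      ∑ r ∈ Finset.range (P.natDegree + 1), (P.coeff r : ℂ) * symb A κ ^ r := by
    intro κ
    rw [Polynomial.eval_eq_sum_range, symb_eq_symbR hA]
    push_cast
    rfl
  simp_rw [hexp, Finset.sum_mul]
  rw [Finset.sum_comm]
  refine Finset.sum_eq_zero fun r hr => ?_
  rw [Finset.mem_range] at hr
  have h := ellOpC_pow_delta_eq_zero A r x (by omega)
  rw [ellOpC_pow_delta] at h
  have h' : ∑ κ, symb A κ ^ r * torusChar κ x = 0 := by
    rcases mul_eq_zero.1 h with h0 | h0
    · exact absurd h0 (inv_ne_zero natCast_pow_ne_zero)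
    · exact h0
  simp_rw [mul_assoc]
  rw [← Finset.mul_sum, h', mul_zero]

/-- **Finite range of polynomial multipliers**: if `m(κ) = P(â(κ))` for `κ ≠ 0` and `m(0) = 0`, then
`mulKernel m (x) = −P(0)/M^d` for `|x|_∞ > deg P` — the kernel is constant (`= M_k ≤ 0` when `P(0) ≥ 0`)
outside the range. [cite: Buchholz2016, Thm 2.4 (iii) and §3 (p. 9)] -/
theorem mulKernel_poly_eq_const {A : Matrix (Fin d) (Fin d) ℝ} (hA : A.IsSymm) (P : ℝ[X])
    {m : (Fin d → ZMod M) → ℝ} (hm : ∀ κ, κ ≠ 0 → m κ = P.eval (symbR A κ)) (hm0 : m 0 = 0)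
    (x : Fin d → ZMod M) (hx : P.natDegree < supNorm x) :
    mulKernel m x = -P.eval 0 / (M : ℝ) ^ d := by
  have hsum : ∑ κ, (m κ : ℂ) * torusChar κ x = -((P.eval 0 : ℝ) : ℂ) := by
    have h0 := sum_poly_symbR_torusChar_eq_zero hA P x hx
    rw [← Finset.add_sum_erase _ _ (Finset.mem_univ (0 : Fin d → ZMod M)), symbR_zero, torusChar_zero_left,
      mul_one] at h0
    rw [← Finset.add_sum_erase _ _ (Finset.mem_univ (0 : Fin d → ZMod M)), hm0, torusChar_zero_left]
    have he : ∑ κ ∈ Finset.univ.erase (0 : Fin d → ZMod M), (m κ : ℂ) * torusChar κ x =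
        ∑ κ ∈ Finset.univ.erase (0 : Fin d → ZMod M), ((P.eval (symbR A κ) : ℝ) : ℂ) * torusChar κ x :=
      sum_congr rfl fun κ hκ => by rw [hm κ (Finset.ne_of_mem_erase hκ)]
    rw [he]
    push_cast
    linear_combination h0
  rw [mulKernel, mulSum, hsum]
  rw [show (((M : ℂ) ^ d))⁻¹ * -((P.eval 0 : ℝ) : ℂ) = ((-P.eval 0 / (M : ℝ) ^ d : ℝ) : ℂ) by push_cast; ring,
    Complex.ofReal_re]

/-! ## Real-space representation of `∇^α mulKernel m` -/

/-- The multiplier of `∇^α`: `q(κ)^α = Π_i q_i(κ)^{α_i}`. [cite: Buchholz2016, App. A (A.12)] -/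
def qpow (α : Fin d → ℕ) (κ : Fin d → ZMod M) : ℂ := ∏ i, qmode κ i ^ α i

/-- `𝓕(∇_j^{[a]} ψ) = q_j^a 𝓕ψ`. [cite: Buchholz2016, §2 (2.18)] -/
theorem fourierCoeff_fwdDiff_iterate (j : Fin d) (a : ℕ) (ψ : (Fin d → ZMod M) → ℝ) (κ : Fin d → ZMod M) :
    fourierCoeff ((fwdDiff j)^[a] ψ) κ = qmode κ j ^ a * fourierCoeff ψ κ := by
  induction a with
  | zero => simp
  | succ a ih => rw [Function.iterate_succ_apply', fourierCoeff_fwdDiff, ih, pow_succ]; ring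

/-- `𝓕(∇^α ψ) = q^α 𝓕ψ`. [cite: Buchholz2016, App. A (A.12)] -/
theorem fourierCoeff_iterDiff (α : Fin d → ℕ) (ψ : (Fin d → ZMod M) → ℝ) (κ : Fin d → ZMod M) :
    fourierCoeff (iterDiff α ψ) κ = qpow α κ * fourierCoeff ψ κ := by
  have hgen : ∀ l : List (Fin d), fourierCoeff (l.foldr (fun i g => (fwdDiff i)^[α i] g) ψ) κ =
      (l.map fun i => qmode κ i ^ α i).prod * fourierCoeff ψ κ := by
    intro l
    induction l with
    | nil => simp
    | cons i l ih => rw [List.foldr_cons, fourierCoeff_fwdDiff_iterate, ih, List.map_cons, List.prod_cons, mul_assoc]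
  rw [iterDiff, hgen, qpow, Fin.prod_univ_def]

/-- **Real-space representation** `∇^α mulKernel m (x) = Σ_κ m(κ) Re(M^{-d} q(κ)^α χ_κ(x))` (even `m`).
[cite: Buchholz2016, App. A (A.12)] -/
theorem iterDiff_mulKernel_eq_sum {m : (Fin d → ZMod M) → ℝ} (hm : ∀ κ, m (-κ) = m κ) (α : Fin d → ℕ)
    (x : Fin d → ZMod M) :
    iterDiff α (mulKernel m) x = ∑ κ, m κ * ((((M : ℂ) ^ d))⁻¹ * qpow α κ * torusChar κ x).re := by
  have h := fourierCoeff_inversion (iterDiff α (mulKernel m)) x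
  simp_rw [fourierCoeff_iterDiff, fourierCoeff_mulKernel hm] at h
  have h' : (iterDiff α (mulKernel m) x : ℂ) = ∑ κ, (m κ : ℂ) * ((((M : ℂ) ^ d))⁻¹ * qpow α κ * torusChar κ x) := by
    rw [h, Finset.mul_sum]
    exact sum_congr rfl fun κ _ => by ring
  apply_fun Complex.re at h'
  rw [Complex.ofReal_re] at h'
  rw [h', Complex.re_sum]
  exact sum_congr rfl fun κ _ => by rw [Complex.re_ofReal_mul]

/-- The case `α = 0`: `mulKernel m (x) = Σ_κ m(κ) Re(M^{-d} χ_κ(x))`. [cite: Buchholz2016, §3 (p. 9)] -/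
theorem mulKernel_eq_sum (m : (Fin d → ZMod M) → ℝ) (x : Fin d → ZMod M) :
    mulKernel m x = ∑ κ, m κ * ((((M : ℂ) ^ d))⁻¹ * torusChar κ x).re := by
  rw [mulKernel, mulSum, Finset.mul_sum, Complex.re_sum]
  exact sum_congr rfl fun κ _ => by rw [← mul_assoc, mul_comm (((M : ℂ) ^ d)⁻¹), mul_assoc, Complex.re_ofReal_mul]

/-- `|q_j(κ)| ≤ |p(κ)|`. [cite: Buchholz2016, §2 (2.19)] -/
theorem norm_qmode_le_momNorm (κ : Fin d → ZMod M) (j : Fin d) : ‖qmode κ j‖ ≤ momNorm κ := by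
  have h1 : ‖qmode κ j‖ ^ 2 ≤ dualMomentum κ j ^ 2 := by
    rw [norm_qmode_sq]
    have h := Real.sin_sq_le_sq (x := dualMomentum κ j / 2)
    nlinarith
  have h2 : dualMomentum κ j ^ 2 ≤ ∑ i, dualMomentum κ i ^ 2 :=
    Finset.single_le_sum (f := fun i => dualMomentum κ i ^ 2) (fun i _ => sq_nonneg _) (Finset.mem_univ j)
  rw [momNorm]
  refine Real.le_sqrt_of_sq_le ?_
  exact h1.trans h2

omit [NeZero M] in
/-- `0 ≤ |p|`. [cite: Buchholz2016, §2] -/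
theorem momNorm_nonneg (κ : Fin d → ZMod M) : 0 ≤ momNorm κ := Real.sqrt_nonneg _

/-- `|q(κ)^α| ≤ |p(κ)|^{|α|}`. [cite: Buchholz2016, App. A (A.12)] -/
theorem norm_qpow_le (α : Fin d → ℕ) (κ : Fin d → ZMod M) : ‖qpow α κ‖ ≤ momNorm κ ^ ∑ i, α i := by
  rw [qpow, norm_prod, ← Finset.prod_pow_eq_pow_sum]
  refine Finset.prod_le_prod (fun i _ => norm_nonneg _) fun i _ => ?_
  rw [norm_pow]
  exact pow_le_pow_left₀ (norm_nonneg _) (norm_qmode_le_momNorm κ i) _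

/-- **The basic real-space bound** `|Σ_κ u(κ) Re(M^{-d} q^α χ_κ(x))| ≤ M^{-d} Σ_κ |u(κ)| |p(κ)|^{|α|}`
(used with `u = m` and with `u = ∂_s^ℓ m`). [cite: Buchholz2016, App. A (A.12)–(A.13)] -/
theorem abs_sum_mul_re_le (u : (Fin d → ZMod M) → ℝ) (α : Fin d → ℕ) (x : Fin d → ZMod M) :
    |∑ κ, u κ * ((((M : ℂ) ^ d))⁻¹ * qpow α κ * torusChar κ x).re| ≤
      (((M : ℝ) ^ d))⁻¹ * ∑ κ, |u κ| * momNorm κ ^ ∑ i, α i := by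
  rw [Finset.mul_sum]
  refine (abs_sum_le_sum_abs _ _).trans (sum_le_sum fun κ _ => ?_)
  rw [abs_mul]
  have hM : ‖(((M : ℂ) ^ d))⁻¹‖ = (((M : ℝ) ^ d))⁻¹ := by
    rw [norm_inv, norm_pow, Complex.norm_natCast]
  calc |u κ| * |((((M : ℂ) ^ d))⁻¹ * qpow α κ * torusChar κ x).re|
      ≤ |u κ| * ‖(((M : ℂ) ^ d))⁻¹ * qpow α κ * torusChar κ x‖ :=
        mul_le_mul_of_nonneg_left (Complex.abs_re_le_norm _) (abs_nonneg _)
    _ = |u κ| * ((((M : ℝ) ^ d))⁻¹ * ‖qpow α κ‖) := by rw [norm_mul, norm_mul, norm_torusChar, mul_one, hM]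
    _ ≤ |u κ| * ((((M : ℝ) ^ d))⁻¹ * momNorm κ ^ ∑ i, α i) :=
        mul_le_mul_of_nonneg_left (mul_le_mul_of_nonneg_left (norm_qpow_le α κ) (by positivity)) (abs_nonneg _)
    _ = (((M : ℝ) ^ d))⁻¹ * (|u κ| * momNorm κ ^ ∑ i, α i) := by ring

end Literature.MathematicalPhysics.StatisticalMechanics.GradientFRD

end
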